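import Summits.BirchSwinnertonDyer.BirchSwinnertonDyer.Theorems.SignedLowerHalvesKobayashiMainConjectureSmallImageSignedMuNFRecordsThree
import HarnessLib

/-!
# Route `SignedLowerHalves`, crux `KobayashiMainConjectureSmallImage` (item stmt-BirchSwinnertonDyer-19002) —
# «L4X-REKEY-NF» part B: the remaining seven PARTNER-FREE `∀ ε` records @ 3 (`314678bz1`, `314678cc1`, `314678r1`,
# `378560fp1`, `430528v1`, `430528y1`, `481888n1`) — same door, same binders, same kit rows as part A
# (`…SmallImageSignedMuNFRecordsThree.lean`, imported; cell `bsd-ssimc`, seat `bsd-ssimc-k3-c4` gen 14;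
# `--supports stmt-BirchSwinnertonDyer-19002 --as helper`; theorems only)

HONEST FRAMING: Kobayashi's signed main conjecture at a non-surjective image is OPEN as a class statement; item 4 stays
OPEN; nothing here is booked; BSD is not proved by any of this.  PER-PAIR theorems, CONDITIONAL on lane B's binder tuple
EXACTLY (`hCK` = the construction fact `Kobayashi2003.thm62_63_73_signedColemanKato_zeta`, p529649; `h12 h41 hKim h5 h3
hGZK hmod'` published) plus per pair the DISPLAYED data (`r_an = 0`, `#Ш_an` a `3`-unit, the EXACT `3`-descent line
`hSel` of the b2b door `bsdp3_nn<label>`, the newform `f₀`, one Mazur–Tate row per sign: even `θ₄`, odd `θ₅`, engines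
B = E identically, kit j280059); `¬Surj` is the KERNEL theorem `SmallImageSelfTwist.not_surj_three_c<label>` (part F1).
NO partner, NO congruence, NO preprint, NO GRH.  Rows, engines, normalisation and stability: see part A's docstring and
memo `HOME/k3c4-MEMO-13.md`.

PARTITION (cell bsd-ssimc): X7 (A7) × seven of the nine rank-0 newform-partnered item-4 pairs @ 3 with a `bsdp3_nn` door —
types-the-object-of (per-pair `∀ ε` MC records); closes NONE; 0 desk cells.

References: [Kobayashi2003] Conj. (p. 2), Thm. 1.2, 4.1, 6.3, 7.3; [BDKim2013] Cor. 3.15; [Pollack2003] Prop. 6.9, 6.10,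
6.18; [GreenbergVatsal2000] §3 Rem. 3.4; [Miller2011LMS] Def. 1.1; [Cremona2006] Table 1.
-/

set_option autoImplicit false
set_option linter.dupNamespace false

noncomputable section

open scoped Classical MatrixGroups ModularForm

open CongruenceSubgroup WeierstrassCurve Field Literature.NumberTheory.EllipticCurves
  Literature.NumberTheory.EllipticCurves.ModularForms
  Literature.NumberTheory.EllipticCurves.Kobayashi2003 Literature.NumberTheory.EllipticCurves.Kato2004
  Literature.NumberTheory.EllipticCurves.GreenbergVatsal2000 ZpExtension
  Literature.NumberTheory.EllipticCurves.Module
  Literature.NumberTheory.EllipticCurves.Rank1Residual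
  Literature.NumberTheory.EllipticCurves.Rank1Residual.Typed
  Literature.NumberTheory.EllipticCurves.Rank1Residual.X11RankOneCertificates
  Summit.BirchSwinnertonDyer.Rank1Residual.X1.MuLambda
  Summit.BirchSwinnertonDyer.Rank1Residual.Supersingular
  Summit.BirchSwinnertonDyer.Rank1Residual.X11b
  Summit.BirchSwinnertonDyer.BirchSwinnertonDyer.Rank1Residual
  Summit.BirchSwinnertonDyer.BirchSwinnertonDyer.Rank1Residual.IntModel
  Summit.BirchSwinnertonDyer.BirchSwinnertonDyer.Rank1Residual.X11RankOne
  Summit.BirchSwinnertonDyer.BirchSwinnertonDyer.Theorems.SmallImageSignedMuTransfer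

namespace Summit.BirchSwinnertonDyer.BirchSwinnertonDyer.Theorems.SmallImageSignedMuNF

section Records

/-- **`314678bz1 @ 3`, BOTH signs: `∀ ε, KobayashiMainConjecture W 3 ε`** (Cremona model `[1, -1, 1, -2238606, -1287188899]`, `N = 314678 = 2·7²·13²·19`,
`r_an = 0`, `∏ c_ℓ = 24`, `#Ш_an = 1`, `#E(ℚ)_tors = 2`; X7, `a_3 = 0`, image `3Nn` with CM shadow `ℚ(√−91)`, NO CM elliptic partner).
PARTNER-FREE: lane B's door + E's OWN rows (kit j280059; engines B = E identically on `(μ, λ)` at all six layers `θ₀…θ₅`): even `θ₄`: `(μ, λ) = (0, 20 + 4)`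
[stable: `θ₂`: `(0, 2 + 4)`], odd `θ₅`: `(μ, λ) = (0, 60 + 4)` [stable: `θ₃`: `(0, 6 + 4)`] ⟹ `μ(L_3^±(E)) = 0`, `λ(L_3^+(E)) = 4`, `λ(L_3^−(E)) = 4`.
`BSD(E,3)` BY NAME = `bsdp3_nn314678bz1` (b2b EXACT 3-descent, kit j131863; `NonsplitCartanThreeDescentRecordsX7Three04`) through its
displayed binders `hr`, `hs`/`hvs`, `hSel`; `¬Surj` = kernel theorem `SmallImageSelfTwist.not_surj_three_c314678bz1`; `3 ∤ Δ`,
`#Ẽ(𝔽_3) = 4` in the kernel.  BY NAME: `hCK` (construction fact, p529649), `h12 h41 hKim h5 h3 hGZK hmod'` (published).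
NO partner / congruence / preprint / GRH.  Per pair; item 4 stays OPEN; nothing booked; BSD is not proved by any of this.
[cite: Kobayashi2003, Conjecture (p. 2), Thm. 1.2, Thm. 4.1, Thm. 6.3 and Thm. 7.3] [cite: BDKim2013, Cor. 3.15 (p. 199)] [cite: Pollack2003, Prop. 6.9, 6.10 and 6.18]
[cite: Miller2011LMS, Def. 1.1] [cite: Cremona2006, Table 1 (Cremona label 314678bz1)] -/
theorem nf_kobayashiMainConjecture_314678bz1_3
    (hCK : thm62_63_73_signedColemanKato_zeta) (h12 : Kobayashi2003.thm12_signedSelmerDual_finite_torsion)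
    (h41 : Kobayashi2003.thm41_signedCharIdeal_divisibility) (hKim : BDKim2013.cor315_signedCharValue_rankZero)
    (h5 : realPeriodRat_eq_unit_mul_plusPeriod) (h3 : realPeriodRat_eq_unit_mul_plusPeriod_three)
    (hGZK : rank_eq_analyticRank_of_analyticRank_le_one) (hmod' : hasEntireLFunction_rat)
    (W : WeierstrassCurve ℚ) [W.IsElliptic] [W.IsGloballyMinimal] [Fact (Nat.Prime 3)] (hW : W = ⟨1, -1, 1, -2238606, -1287188899⟩)
    (hr : W.analyticRank = 0) {s : ℚ} (hs : shaAn W = (s : ℂ)) (hvs : padicValRat 3 s = 0)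
    (hSel : Nat.card (W.selmerGroup (3 : ℤ)) = 3 ^ W.analyticRank)
    [NeZero (W.conductorNorm ℤ)] {f₀ : CuspForm (Gamma0 (W.conductorNorm ℤ)) 2} (hf₀ : IsNewformOf W f₀)
    {Θ₄ Θ₅ : IwasawaAlgebra 3}
    (hΘ₄ : iwasawaToPowerSeries 3 Θ₄ = ((mazurTateElement f₀ 3 4).map (algebraMap ℚ ℚ_[3]) : PowerSeries ℚ_[3]))
    (hΘ₄0 : Θ₄ ≠ 0) (hμ₄ : mu Θ₄ = 0) (hlam₄ : lam Θ₄ = (cyclotomicOmegaMinus 3 4).natDegree + 4)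
    (hΘ₅ : iwasawaToPowerSeries 3 Θ₅ = ((mazurTateElement f₀ 3 5).map (algebraMap ℚ ℚ_[3]) : PowerSeries ℚ_[3]))
    (hΘ₅0 : Θ₅ ≠ 0) (hμ₅ : mu Θ₅ = 0) (hlam₅ : lam Θ₅ = (cyclotomicOmegaPlus 3 5).natDegree + 4) :
    ∀ ε : ℤˣ, KobayashiMainConjecture W 3 ε := by
  have hI : integralModelInt W = ⟨1, -1, 1, -2238606, -1287188899⟩ :=
    integralModelInt_eq_of_map_eq _ (by rw [hW]; ext <;> simp [WeierstrassCurve.map])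
  have hΔ : (⟨1, -1, 1, -2238606, -1287188899⟩ : WeierstrassCurve ℤ).Δ = discOf [1, -1, 1, -2238606, -1287188899] :=
    intCurve_Δ 1 (-1) 1 (-2238606) (-1287188899)
  have hgood : W.HasGoodReductionAtPrime 3 :=
    hasGoodReductionAtPrime_of_not_dvd W 3 (by rw [minimalDiscriminantInt_eq hI, hΔ]; decide +kernel)
  have hap : W.frobeniusTrace 3 = 0 := by rw [frobeniusTrace_eq hI card_nf314678bz1_3]; norm_num
  exact forall_kobayashiMainConjecture_three_of_rows hCK h12 h41 hKim h5 h3 hGZK hmod' W hgood hap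
    (SmallImageSelfTwist.not_surj_three_c314678bz1 W hW) hf₀ hΘ₄ hΘ₄0 hμ₄ hlam₄ hΘ₅ hΘ₅0 hμ₅ hlam₅ hr
    (bsdp3_nn314678bz1 hGZK W hW (hr.trans_le zero_le_one) hs hvs hSel)

/-- **`314678cc1 @ 3`, BOTH signs: `∀ ε, KobayashiMainConjecture W 3 ε`** (Cremona model `[1, -1, 1, 1160153, 71914847]`, `N = 314678 = 2·7²·13²·19`,
`r_an = 0`, `∏ c_ℓ = 48`, `#Ш_an = 1`, `#E(ℚ)_tors = 1`; X7, `a_3 = 0`, image `3Nn` with CM shadow `ℚ(√−91)`, NO CM elliptic partner).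
PARTNER-FREE: lane B's door + E's OWN rows (kit j280059; engines B = E identically on `(μ, λ)` at all six layers `θ₀…θ₅`): even `θ₄`: `(μ, λ) = (0, 20 + 4)`
[stable: `θ₂`: `(0, 2 + 4)`], odd `θ₅`: `(μ, λ) = (0, 60 + 4)` [stable: `θ₃`: `(0, 6 + 4)`] ⟹ `μ(L_3^±(E)) = 0`, `λ(L_3^+(E)) = 4`, `λ(L_3^−(E)) = 4`.
`BSD(E,3)` BY NAME = `bsdp3_nn314678cc1` (b2b EXACT 3-descent, kit j131863; `NonsplitCartanThreeDescentRecordsX7Three04`) through its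
displayed binders `hr`, `hs`/`hvs`, `hSel`; `¬Surj` = kernel theorem `SmallImageSelfTwist.not_surj_three_c314678cc1`; `3 ∤ Δ`,
`#Ẽ(𝔽_3) = 4` in the kernel.  BY NAME: `hCK` (construction fact, p529649), `h12 h41 hKim h5 h3 hGZK hmod'` (published).
NO partner / congruence / preprint / GRH.  Per pair; item 4 stays OPEN; nothing booked; BSD is not proved by any of this.
[cite: Kobayashi2003, Conjecture (p. 2), Thm. 1.2, Thm. 4.1, Thm. 6.3 and Thm. 7.3] [cite: BDKim2013, Cor. 3.15 (p. 199)] [cite: Pollack2003, Prop. 6.9, 6.10 and 6.18]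
[cite: Miller2011LMS, Def. 1.1] [cite: Cremona2006, Table 1 (Cremona label 314678cc1)] -/
theorem nf_kobayashiMainConjecture_314678cc1_3
    (hCK : thm62_63_73_signedColemanKato_zeta) (h12 : Kobayashi2003.thm12_signedSelmerDual_finite_torsion)
    (h41 : Kobayashi2003.thm41_signedCharIdeal_divisibility) (hKim : BDKim2013.cor315_signedCharValue_rankZero)
    (h5 : realPeriodRat_eq_unit_mul_plusPeriod) (h3 : realPeriodRat_eq_unit_mul_plusPeriod_three)
    (hGZK : rank_eq_analyticRank_of_analyticRank_le_one) (hmod' : hasEntireLFunction_rat)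
    (W : WeierstrassCurve ℚ) [W.IsElliptic] [W.IsGloballyMinimal] [Fact (Nat.Prime 3)] (hW : W = ⟨1, -1, 1, 1160153, 71914847⟩)
    (hr : W.analyticRank = 0) {s : ℚ} (hs : shaAn W = (s : ℂ)) (hvs : padicValRat 3 s = 0)
    (hSel : Nat.card (W.selmerGroup (3 : ℤ)) = 3 ^ W.analyticRank)
    [NeZero (W.conductorNorm ℤ)] {f₀ : CuspForm (Gamma0 (W.conductorNorm ℤ)) 2} (hf₀ : IsNewformOf W f₀)
    {Θ₄ Θ₅ : IwasawaAlgebra 3}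
    (hΘ₄ : iwasawaToPowerSeries 3 Θ₄ = ((mazurTateElement f₀ 3 4).map (algebraMap ℚ ℚ_[3]) : PowerSeries ℚ_[3]))
    (hΘ₄0 : Θ₄ ≠ 0) (hμ₄ : mu Θ₄ = 0) (hlam₄ : lam Θ₄ = (cyclotomicOmegaMinus 3 4).natDegree + 4)
    (hΘ₅ : iwasawaToPowerSeries 3 Θ₅ = ((mazurTateElement f₀ 3 5).map (algebraMap ℚ ℚ_[3]) : PowerSeries ℚ_[3]))
    (hΘ₅0 : Θ₅ ≠ 0) (hμ₅ : mu Θ₅ = 0) (hlam₅ : lam Θ₅ = (cyclotomicOmegaPlus 3 5).natDegree + 4) :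
    ∀ ε : ℤˣ, KobayashiMainConjecture W 3 ε := by
  have hI : integralModelInt W = ⟨1, -1, 1, 1160153, 71914847⟩ :=
    integralModelInt_eq_of_map_eq _ (by rw [hW]; ext <;> simp [WeierstrassCurve.map])
  have hΔ : (⟨1, -1, 1, 1160153, 71914847⟩ : WeierstrassCurve ℤ).Δ = discOf [1, -1, 1, 1160153, 71914847] :=
    intCurve_Δ 1 (-1) 1 1160153 71914847
  have hgood : W.HasGoodReductionAtPrime 3 :=
    hasGoodReductionAtPrime_of_not_dvd W 3 (by rw [minimalDiscriminantInt_eq hI, hΔ]; decide +kernel)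
  have hap : W.frobeniusTrace 3 = 0 := by rw [frobeniusTrace_eq hI card_nf314678cc1_3]; norm_num
  exact forall_kobayashiMainConjecture_three_of_rows hCK h12 h41 hKim h5 h3 hGZK hmod' W hgood hap
    (SmallImageSelfTwist.not_surj_three_c314678cc1 W hW) hf₀ hΘ₄ hΘ₄0 hμ₄ hlam₄ hΘ₅ hΘ₅0 hμ₅ hlam₅ hr
    (bsdp3_nn314678cc1 hGZK W hW (hr.trans_le zero_le_one) hs hvs hSel)

/-- **`314678r1 @ 3`, BOTH signs: `∀ ε, KobayashiMainConjecture W 3 ε`** (Cremona model `[1, -1, 0, -13246, -582828]`, `N = 314678 = 2·7²·13²·19`,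
`r_an = 0`, `∏ c_ℓ = 24`, `#Ш_an = 1`, `#E(ℚ)_tors = 2`; X7, `a_3 = 0`, image `3Nn` with CM shadow `ℚ(√−91)`, NO CM elliptic partner).
PARTNER-FREE: lane B's door + E's OWN rows (kit j280059; engines B = E identically on `(μ, λ)` at all six layers `θ₀…θ₅`): even `θ₄`: `(μ, λ) = (0, 20 + 6)`
[stable: `θ₂`: `(0, 2 + 6)`], odd `θ₅`: `(μ, λ) = (0, 60 + 4)` [stable: `θ₃`: `(0, 6 + 4)`] ⟹ `μ(L_3^±(E)) = 0`, `λ(L_3^+(E)) = 6`, `λ(L_3^−(E)) = 4`.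
`BSD(E,3)` BY NAME = `bsdp3_nn314678r1` (b2b EXACT 3-descent, kit j131863; `NonsplitCartanThreeDescentRecordsX7Three04`) through its
displayed binders `hr`, `hs`/`hvs`, `hSel`; `¬Surj` = kernel theorem `SmallImageSelfTwist.not_surj_three_c314678r1`; `3 ∤ Δ`,
`#Ẽ(𝔽_3) = 4` in the kernel.  BY NAME: `hCK` (construction fact, p529649), `h12 h41 hKim h5 h3 hGZK hmod'` (published).
NO partner / congruence / preprint / GRH.  Per pair; item 4 stays OPEN; nothing booked; BSD is not proved by any of this.
[cite: Kobayashi2003, Conjecture (p. 2), Thm. 1.2, Thm. 4.1, Thm. 6.3 and Thm. 7.3] [cite: BDKim2013, Cor. 3.15 (p. 199)] [cite: Pollack2003, Prop. 6.9, 6.10 and 6.18]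
[cite: Miller2011LMS, Def. 1.1] [cite: Cremona2006, Table 1 (Cremona label 314678r1)] -/
theorem nf_kobayashiMainConjecture_314678r1_3
    (hCK : thm62_63_73_signedColemanKato_zeta) (h12 : Kobayashi2003.thm12_signedSelmerDual_finite_torsion)
    (h41 : Kobayashi2003.thm41_signedCharIdeal_divisibility) (hKim : BDKim2013.cor315_signedCharValue_rankZero)
    (h5 : realPeriodRat_eq_unit_mul_plusPeriod) (h3 : realPeriodRat_eq_unit_mul_plusPeriod_three)
    (hGZK : rank_eq_analyticRank_of_analyticRank_le_one) (hmod' : hasEntireLFunction_rat)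
    (W : WeierstrassCurve ℚ) [W.IsElliptic] [W.IsGloballyMinimal] [Fact (Nat.Prime 3)] (hW : W = ⟨1, -1, 0, -13246, -582828⟩)
    (hr : W.analyticRank = 0) {s : ℚ} (hs : shaAn W = (s : ℂ)) (hvs : padicValRat 3 s = 0)
    (hSel : Nat.card (W.selmerGroup (3 : ℤ)) = 3 ^ W.analyticRank)
    [NeZero (W.conductorNorm ℤ)] {f₀ : CuspForm (Gamma0 (W.conductorNorm ℤ)) 2} (hf₀ : IsNewformOf W f₀)
    {Θ₄ Θ₅ : IwasawaAlgebra 3}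
    (hΘ₄ : iwasawaToPowerSeries 3 Θ₄ = ((mazurTateElement f₀ 3 4).map (algebraMap ℚ ℚ_[3]) : PowerSeries ℚ_[3]))
    (hΘ₄0 : Θ₄ ≠ 0) (hμ₄ : mu Θ₄ = 0) (hlam₄ : lam Θ₄ = (cyclotomicOmegaMinus 3 4).natDegree + 6)
    (hΘ₅ : iwasawaToPowerSeries 3 Θ₅ = ((mazurTateElement f₀ 3 5).map (algebraMap ℚ ℚ_[3]) : PowerSeries ℚ_[3]))
    (hΘ₅0 : Θ₅ ≠ 0) (hμ₅ : mu Θ₅ = 0) (hlam₅ : lam Θ₅ = (cyclotomicOmegaPlus 3 5).natDegree + 4) :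
    ∀ ε : ℤˣ, KobayashiMainConjecture W 3 ε := by
  have hI : integralModelInt W = ⟨1, -1, 0, -13246, -582828⟩ :=
    integralModelInt_eq_of_map_eq _ (by rw [hW]; ext <;> simp [WeierstrassCurve.map])
  have hΔ : (⟨1, -1, 0, -13246, -582828⟩ : WeierstrassCurve ℤ).Δ = discOf [1, -1, 0, -13246, -582828] :=
    intCurve_Δ 1 (-1) 0 (-13246) (-582828)
  have hgood : W.HasGoodReductionAtPrime 3 :=
    hasGoodReductionAtPrime_of_not_dvd W 3 (by rw [minimalDiscriminantInt_eq hI, hΔ]; decide +kernel)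
  have hap : W.frobeniusTrace 3 = 0 := by rw [frobeniusTrace_eq hI card_nf314678r1_3]; norm_num
  exact forall_kobayashiMainConjecture_three_of_rows hCK h12 h41 hKim h5 h3 hGZK hmod' W hgood hap
    (SmallImageSelfTwist.not_surj_three_c314678r1 W hW) hf₀ hΘ₄ hΘ₄0 hμ₄ hlam₄ hΘ₅ hΘ₅0 hμ₅ hlam₅ hr
    (bsdp3_nn314678r1 hGZK W hW (hr.trans_le zero_le_one) hs hvs hSel)

/-- **`378560fp1 @ 3`, BOTH signs: `∀ ε, KobayashiMainConjecture W 3 ε`** (Cremona model `[0, 0, 0, -5032087892, -127118829942624]`, `N = 378560 = 2⁶·5·7·13²`,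
`r_an = 0`, `∏ c_ℓ = 864`, `#Ш_an = 1`, `#E(ℚ)_tors = 2`; X7, `a_3 = 0`, image `3Nn` with CM shadow `ℚ(√−13)`, NO CM elliptic partner).
PARTNER-FREE: lane B's door + E's OWN rows (kit j280059; engines B = E identically on `(μ, λ)` at all six layers `θ₀…θ₅`): even `θ₄`: `(μ, λ) = (0, 20 + 4)`
[stable: `θ₂`: `(0, 2 + 4)`], odd `θ₅`: `(μ, λ) = (0, 60 + 4)` [stable: `θ₃`: `(0, 6 + 4)`] ⟹ `μ(L_3^±(E)) = 0`, `λ(L_3^+(E)) = 4`, `λ(L_3^−(E)) = 4`.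
`BSD(E,3)` BY NAME = `bsdp3_nn378560fp1` (b2b EXACT 3-descent, kit j131863; `NonsplitCartanThreeDescentRecordsX7Three05`) through its
displayed binders `hr`, `hs`/`hvs`, `hSel`; `¬Surj` = kernel theorem `SmallImageSelfTwist.not_surj_three_c378560fp1`; `3 ∤ Δ`,
`#Ẽ(𝔽_3) = 4` in the kernel.  BY NAME: `hCK` (construction fact, p529649), `h12 h41 hKim h5 h3 hGZK hmod'` (published).
NO partner / congruence / preprint / GRH.  Per pair; item 4 stays OPEN; nothing booked; BSD is not proved by any of this.
[cite: Kobayashi2003, Conjecture (p. 2), Thm. 1.2, Thm. 4.1, Thm. 6.3 and Thm. 7.3] [cite: BDKim2013, Cor. 3.15 (p. 199)] [cite: Pollack2003, Prop. 6.9, 6.10 and 6.18]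
[cite: Miller2011LMS, Def. 1.1] [cite: Cremona2006, Table 1 (Cremona label 378560fp1)] -/
theorem nf_kobayashiMainConjecture_378560fp1_3
    (hCK : thm62_63_73_signedColemanKato_zeta) (h12 : Kobayashi2003.thm12_signedSelmerDual_finite_torsion)
    (h41 : Kobayashi2003.thm41_signedCharIdeal_divisibility) (hKim : BDKim2013.cor315_signedCharValue_rankZero)
    (h5 : realPeriodRat_eq_unit_mul_plusPeriod) (h3 : realPeriodRat_eq_unit_mul_plusPeriod_three)
    (hGZK : rank_eq_analyticRank_of_analyticRank_le_one) (hmod' : hasEntireLFunction_rat)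
    (W : WeierstrassCurve ℚ) [W.IsElliptic] [W.IsGloballyMinimal] [Fact (Nat.Prime 3)] (hW : W = ⟨0, 0, 0, -5032087892, -127118829942624⟩)
    (hr : W.analyticRank = 0) {s : ℚ} (hs : shaAn W = (s : ℂ)) (hvs : padicValRat 3 s = 0)
    (hSel : Nat.card (W.selmerGroup (3 : ℤ)) = 3 ^ W.analyticRank)
    [NeZero (W.conductorNorm ℤ)] {f₀ : CuspForm (Gamma0 (W.conductorNorm ℤ)) 2} (hf₀ : IsNewformOf W f₀)
    {Θ₄ Θ₅ : IwasawaAlgebra 3}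
    (hΘ₄ : iwasawaToPowerSeries 3 Θ₄ = ((mazurTateElement f₀ 3 4).map (algebraMap ℚ ℚ_[3]) : PowerSeries ℚ_[3]))
    (hΘ₄0 : Θ₄ ≠ 0) (hμ₄ : mu Θ₄ = 0) (hlam₄ : lam Θ₄ = (cyclotomicOmegaMinus 3 4).natDegree + 4)
    (hΘ₅ : iwasawaToPowerSeries 3 Θ₅ = ((mazurTateElement f₀ 3 5).map (algebraMap ℚ ℚ_[3]) : PowerSeries ℚ_[3]))
    (hΘ₅0 : Θ₅ ≠ 0) (hμ₅ : mu Θ₅ = 0) (hlam₅ : lam Θ₅ = (cyclotomicOmegaPlus 3 5).natDegree + 4) :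
    ∀ ε : ℤˣ, KobayashiMainConjecture W 3 ε := by
  have hI : integralModelInt W = ⟨0, 0, 0, -5032087892, -127118829942624⟩ :=
    integralModelInt_eq_of_map_eq _ (by rw [hW]; ext <;> simp [WeierstrassCurve.map])
  have hΔ : (⟨0, 0, 0, -5032087892, -127118829942624⟩ : WeierstrassCurve ℤ).Δ = discOf [0, 0, 0, -5032087892, -127118829942624] :=
    intCurve_Δ 0 0 0 (-5032087892) (-127118829942624)
  have hgood : W.HasGoodReductionAtPrime 3 :=
    hasGoodReductionAtPrime_of_not_dvd W 3 (by rw [minimalDiscriminantInt_eq hI, hΔ]; decide +kernel)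
  have hap : W.frobeniusTrace 3 = 0 := by rw [frobeniusTrace_eq hI card_nf378560fp1_3]; norm_num
  exact forall_kobayashiMainConjecture_three_of_rows hCK h12 h41 hKim h5 h3 hGZK hmod' W hgood hap
    (SmallImageSelfTwist.not_surj_three_c378560fp1 W hW) hf₀ hΘ₄ hΘ₄0 hμ₄ hlam₄ hΘ₅ hΘ₅0 hμ₅ hlam₅ hr
    (bsdp3_nn378560fp1 hGZK W hW (hr.trans_le zero_le_one) hs hvs hSel)

/-- **`430528v1 @ 3`, BOTH signs: `∀ ε, KobayashiMainConjecture W 3 ε`** (Cremona model `[0, 0, 0, -13516, -599664]`, `N = 430528 = 2⁹·29²`,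
`r_an = 0`, `∏ c_ℓ = 24`, `#Ш_an = 1`, `#E(ℚ)_tors = 2`; X7, `a_3 = 0`, image `3Nn` with CM shadow `ℚ(√−31)`, NO CM elliptic partner).
PARTNER-FREE: lane B's door + E's OWN rows (kit j280059; engines B = E identically on `(μ, λ)` at all six layers `θ₀…θ₅`): even `θ₄`: `(μ, λ) = (0, 20 + 6)`
[stable: `θ₂`: `(0, 2 + 6)`], odd `θ₅`: `(μ, λ) = (0, 60 + 4)` [stable: `θ₃`: `(0, 6 + 4)`] ⟹ `μ(L_3^±(E)) = 0`, `λ(L_3^+(E)) = 6`, `λ(L_3^−(E)) = 4`.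
`BSD(E,3)` BY NAME = `bsdp3_nn430528v1` (b2b EXACT 3-descent, kit j131863; `NonsplitCartanThreeDescentRecordsX7Three06`) through its
displayed binders `hr`, `hs`/`hvs`, `hSel`; `¬Surj` = kernel theorem `SmallImageSelfTwist.not_surj_three_c430528v1`; `3 ∤ Δ`,
`#Ẽ(𝔽_3) = 4` in the kernel.  BY NAME: `hCK` (construction fact, p529649), `h12 h41 hKim h5 h3 hGZK hmod'` (published).
NO partner / congruence / preprint / GRH.  Per pair; item 4 stays OPEN; nothing booked; BSD is not proved by any of this.
[cite: Kobayashi2003, Conjecture (p. 2), Thm. 1.2, Thm. 4.1, Thm. 6.3 and Thm. 7.3] [cite: BDKim2013, Cor. 3.15 (p. 199)] [cite: Pollack2003, Prop. 6.9, 6.10 and 6.18]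
[cite: Miller2011LMS, Def. 1.1] [cite: Cremona2006, Table 1 (Cremona label 430528v1)] -/
theorem nf_kobayashiMainConjecture_430528v1_3
    (hCK : thm62_63_73_signedColemanKato_zeta) (h12 : Kobayashi2003.thm12_signedSelmerDual_finite_torsion)
    (h41 : Kobayashi2003.thm41_signedCharIdeal_divisibility) (hKim : BDKim2013.cor315_signedCharValue_rankZero)
    (h5 : realPeriodRat_eq_unit_mul_plusPeriod) (h3 : realPeriodRat_eq_unit_mul_plusPeriod_three)
    (hGZK : rank_eq_analyticRank_of_analyticRank_le_one) (hmod' : hasEntireLFunction_rat)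
    (W : WeierstrassCurve ℚ) [W.IsElliptic] [W.IsGloballyMinimal] [Fact (Nat.Prime 3)] (hW : W = ⟨0, 0, 0, -13516, -599664⟩)
    (hr : W.analyticRank = 0) {s : ℚ} (hs : shaAn W = (s : ℂ)) (hvs : padicValRat 3 s = 0)
    (hSel : Nat.card (W.selmerGroup (3 : ℤ)) = 3 ^ W.analyticRank)
    [NeZero (W.conductorNorm ℤ)] {f₀ : CuspForm (Gamma0 (W.conductorNorm ℤ)) 2} (hf₀ : IsNewformOf W f₀)
    {Θ₄ Θ₅ : IwasawaAlgebra 3}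
    (hΘ₄ : iwasawaToPowerSeries 3 Θ₄ = ((mazurTateElement f₀ 3 4).map (algebraMap ℚ ℚ_[3]) : PowerSeries ℚ_[3]))
    (hΘ₄0 : Θ₄ ≠ 0) (hμ₄ : mu Θ₄ = 0) (hlam₄ : lam Θ₄ = (cyclotomicOmegaMinus 3 4).natDegree + 6)
    (hΘ₅ : iwasawaToPowerSeries 3 Θ₅ = ((mazurTateElement f₀ 3 5).map (algebraMap ℚ ℚ_[3]) : PowerSeries ℚ_[3]))
    (hΘ₅0 : Θ₅ ≠ 0) (hμ₅ : mu Θ₅ = 0) (hlam₅ : lam Θ₅ = (cyclotomicOmegaPlus 3 5).natDegree + 4) :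
    ∀ ε : ℤˣ, KobayashiMainConjecture W 3 ε := by
  have hI : integralModelInt W = ⟨0, 0, 0, -13516, -599664⟩ :=
    integralModelInt_eq_of_map_eq _ (by rw [hW]; ext <;> simp [WeierstrassCurve.map])
  have hΔ : (⟨0, 0, 0, -13516, -599664⟩ : WeierstrassCurve ℤ).Δ = discOf [0, 0, 0, -13516, -599664] :=
    intCurve_Δ 0 0 0 (-13516) (-599664)
  have hgood : W.HasGoodReductionAtPrime 3 :=
    hasGoodReductionAtPrime_of_not_dvd W 3 (by rw [minimalDiscriminantInt_eq hI, hΔ]; decide +kernel)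
  have hap : W.frobeniusTrace 3 = 0 := by rw [frobeniusTrace_eq hI card_nf430528v1_3]; norm_num
  exact forall_kobayashiMainConjecture_three_of_rows hCK h12 h41 hKim h5 h3 hGZK hmod' W hgood hap
    (SmallImageSelfTwist.not_surj_three_c430528v1 W hW) hf₀ hΘ₄ hΘ₄0 hμ₄ hlam₄ hΘ₅ hΘ₅0 hμ₅ hlam₅ hr
    (bsdp3_nn430528v1 hGZK W hW (hr.trans_le zero_le_one) hs hvs hSel)

/-- **`430528y1 @ 3`, BOTH signs: `∀ ε, KobayashiMainConjecture W 3 ε`** (Cremona model `[0, 0, 0, -12988876, 17864590224]`, `N = 430528 = 2⁹·29²`,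
`r_an = 0`, `∏ c_ℓ = 24`, `#Ш_an = 1`, `#E(ℚ)_tors = 2`; X7, `a_3 = 0`, image `3Nn` with CM shadow `ℚ(√−31)`, NO CM elliptic partner).
PARTNER-FREE: lane B's door + E's OWN rows (kit j280059; engines B = E identically on `(μ, λ)` at all six layers `θ₀…θ₅`): even `θ₄`: `(μ, λ) = (0, 20 + 6)`
[stable: `θ₂`: `(0, 2 + 6)`], odd `θ₅`: `(μ, λ) = (0, 60 + 4)` [stable: `θ₃`: `(0, 6 + 4)`] ⟹ `μ(L_3^±(E)) = 0`, `λ(L_3^+(E)) = 6`, `λ(L_3^−(E)) = 4`.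
`BSD(E,3)` BY NAME = `bsdp3_nn430528y1` (b2b EXACT 3-descent, kit j131863; `NonsplitCartanThreeDescentRecordsX7Three06`) through its
displayed binders `hr`, `hs`/`hvs`, `hSel`; `¬Surj` = kernel theorem `SmallImageSelfTwist.not_surj_three_c430528y1`; `3 ∤ Δ`,
`#Ẽ(𝔽_3) = 4` in the kernel.  BY NAME: `hCK` (construction fact, p529649), `h12 h41 hKim h5 h3 hGZK hmod'` (published).
NO partner / congruence / preprint / GRH.  Per pair; item 4 stays OPEN; nothing booked; BSD is not proved by any of this.
[cite: Kobayashi2003, Conjecture (p. 2), Thm. 1.2, Thm. 4.1, Thm. 6.3 and Thm. 7.3] [cite: BDKim2013, Cor. 3.15 (p. 199)] [cite: Pollack2003, Prop. 6.9, 6.10 and 6.18]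
[cite: Miller2011LMS, Def. 1.1] [cite: Cremona2006, Table 1 (Cremona label 430528y1)] -/
theorem nf_kobayashiMainConjecture_430528y1_3
    (hCK : thm62_63_73_signedColemanKato_zeta) (h12 : Kobayashi2003.thm12_signedSelmerDual_finite_torsion)
    (h41 : Kobayashi2003.thm41_signedCharIdeal_divisibility) (hKim : BDKim2013.cor315_signedCharValue_rankZero)
    (h5 : realPeriodRat_eq_unit_mul_plusPeriod) (h3 : realPeriodRat_eq_unit_mul_plusPeriod_three)
    (hGZK : rank_eq_analyticRank_of_analyticRank_le_one) (hmod' : hasEntireLFunction_rat)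
    (W : WeierstrassCurve ℚ) [W.IsElliptic] [W.IsGloballyMinimal] [Fact (Nat.Prime 3)] (hW : W = ⟨0, 0, 0, -12988876, 17864590224⟩)
    (hr : W.analyticRank = 0) {s : ℚ} (hs : shaAn W = (s : ℂ)) (hvs : padicValRat 3 s = 0)
    (hSel : Nat.card (W.selmerGroup (3 : ℤ)) = 3 ^ W.analyticRank)
    [NeZero (W.conductorNorm ℤ)] {f₀ : CuspForm (Gamma0 (W.conductorNorm ℤ)) 2} (hf₀ : IsNewformOf W f₀)
    {Θ₄ Θ₅ : IwasawaAlgebra 3}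
    (hΘ₄ : iwasawaToPowerSeries 3 Θ₄ = ((mazurTateElement f₀ 3 4).map (algebraMap ℚ ℚ_[3]) : PowerSeries ℚ_[3]))
    (hΘ₄0 : Θ₄ ≠ 0) (hμ₄ : mu Θ₄ = 0) (hlam₄ : lam Θ₄ = (cyclotomicOmegaMinus 3 4).natDegree + 6)
    (hΘ₅ : iwasawaToPowerSeries 3 Θ₅ = ((mazurTateElement f₀ 3 5).map (algebraMap ℚ ℚ_[3]) : PowerSeries ℚ_[3]))
    (hΘ₅0 : Θ₅ ≠ 0) (hμ₅ : mu Θ₅ = 0) (hlam₅ : lam Θ₅ = (cyclotomicOmegaPlus 3 5).natDegree + 4) :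
    ∀ ε : ℤˣ, KobayashiMainConjecture W 3 ε := by
  have hI : integralModelInt W = ⟨0, 0, 0, -12988876, 17864590224⟩ :=
    integralModelInt_eq_of_map_eq _ (by rw [hW]; ext <;> simp [WeierstrassCurve.map])
  have hΔ : (⟨0, 0, 0, -12988876, 17864590224⟩ : WeierstrassCurve ℤ).Δ = discOf [0, 0, 0, -12988876, 17864590224] :=
    intCurve_Δ 0 0 0 (-12988876) 17864590224
  have hgood : W.HasGoodReductionAtPrime 3 :=
    hasGoodReductionAtPrime_of_not_dvd W 3 (by rw [minimalDiscriminantInt_eq hI, hΔ]; decide +kernel)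
  have hap : W.frobeniusTrace 3 = 0 := by rw [frobeniusTrace_eq hI card_nf430528y1_3]; norm_num
  exact forall_kobayashiMainConjecture_three_of_rows hCK h12 h41 hKim h5 h3 hGZK hmod' W hgood hap
    (SmallImageSelfTwist.not_surj_three_c430528y1 W hW) hf₀ hΘ₄ hΘ₄0 hμ₄ hlam₄ hΘ₅ hΘ₅0 hμ₅ hlam₅ hr
    (bsdp3_nn430528y1 hGZK W hW (hr.trans_le zero_le_one) hs hvs hSel)

/-- **`481888n1 @ 3`, BOTH signs: `∀ ε, KobayashiMainConjecture W 3 ε`** (Cremona model `[0, 0, 0, -16465, -804972]`, `N = 481888 = 2⁵·11·37²`,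
`r_an = 0`, `∏ c_ℓ = 24`, `#Ш_an = 1`, `#E(ℚ)_tors = 2`; X7, `a_3 = 0`, image `3Nn` with CM shadow `ℚ(√−37)`, NO CM elliptic partner).
PARTNER-FREE: lane B's door + E's OWN rows (kit j280059; engines B = E identically on `(μ, λ)` at all six layers `θ₀…θ₅`): even `θ₄`: `(μ, λ) = (0, 20 + 10)`
[`θ₂` DEGENERATE: `(μ, λ) = (1, 2)` on both engines, as FORCED by `l₊ + deg ω₂⁻ = 12 ≥ 3²`
(`mazurTate_eq_zero_or_mu_pos_of_le_flat`); stability witness `θ₆` (`deg ω₆⁻ = 182`, kit j283062): `(0, 182 + 10)` on BOTH engines], odd `θ₅`: `(μ, λ) = (0, 60 + 6)` [stable: `θ₃`: `(0, 6 + 6)`] ⟹ `μ(L_3^±(E)) = 0`, `λ(L_3^+(E)) = 10`, `λ(L_3^−(E)) = 6`.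
`BSD(E,3)` BY NAME = `bsdp3_nn481888n1` (b2b EXACT 3-descent, kit j131863; `NonsplitCartanThreeDescentRecordsX7Three06`) through its
displayed binders `hr`, `hs`/`hvs`, `hSel`; `¬Surj` = kernel theorem `SmallImageSelfTwist.not_surj_three_c481888n1`; `3 ∤ Δ`,
`#Ẽ(𝔽_3) = 4` in the kernel.  BY NAME: `hCK` (construction fact, p529649), `h12 h41 hKim h5 h3 hGZK hmod'` (published).
NO partner / congruence / preprint / GRH.  Per pair; item 4 stays OPEN; nothing booked; BSD is not proved by any of this.
[cite: Kobayashi2003, Conjecture (p. 2), Thm. 1.2, Thm. 4.1, Thm. 6.3 and Thm. 7.3] [cite: BDKim2013, Cor. 3.15 (p. 199)] [cite: Pollack2003, Prop. 6.9, 6.10 and 6.18]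
[cite: Miller2011LMS, Def. 1.1] [cite: Cremona2006, Table 1 (Cremona label 481888n1)] -/
theorem nf_kobayashiMainConjecture_481888n1_3
    (hCK : thm62_63_73_signedColemanKato_zeta) (h12 : Kobayashi2003.thm12_signedSelmerDual_finite_torsion)
    (h41 : Kobayashi2003.thm41_signedCharIdeal_divisibility) (hKim : BDKim2013.cor315_signedCharValue_rankZero)
    (h5 : realPeriodRat_eq_unit_mul_plusPeriod) (h3 : realPeriodRat_eq_unit_mul_plusPeriod_three)
    (hGZK : rank_eq_analyticRank_of_analyticRank_le_one) (hmod' : hasEntireLFunction_rat)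
    (W : WeierstrassCurve ℚ) [W.IsElliptic] [W.IsGloballyMinimal] [Fact (Nat.Prime 3)] (hW : W = ⟨0, 0, 0, -16465, -804972⟩)
    (hr : W.analyticRank = 0) {s : ℚ} (hs : shaAn W = (s : ℂ)) (hvs : padicValRat 3 s = 0)
    (hSel : Nat.card (W.selmerGroup (3 : ℤ)) = 3 ^ W.analyticRank)
    [NeZero (W.conductorNorm ℤ)] {f₀ : CuspForm (Gamma0 (W.conductorNorm ℤ)) 2} (hf₀ : IsNewformOf W f₀)
    {Θ₄ Θ₅ : IwasawaAlgebra 3}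
    (hΘ₄ : iwasawaToPowerSeries 3 Θ₄ = ((mazurTateElement f₀ 3 4).map (algebraMap ℚ ℚ_[3]) : PowerSeries ℚ_[3]))
    (hΘ₄0 : Θ₄ ≠ 0) (hμ₄ : mu Θ₄ = 0) (hlam₄ : lam Θ₄ = (cyclotomicOmegaMinus 3 4).natDegree + 10)
    (hΘ₅ : iwasawaToPowerSeries 3 Θ₅ = ((mazurTateElement f₀ 3 5).map (algebraMap ℚ ℚ_[3]) : PowerSeries ℚ_[3]))
    (hΘ₅0 : Θ₅ ≠ 0) (hμ₅ : mu Θ₅ = 0) (hlam₅ : lam Θ₅ = (cyclotomicOmegaPlus 3 5).natDegree + 6) :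
    ∀ ε : ℤˣ, KobayashiMainConjecture W 3 ε := by
  have hI : integralModelInt W = ⟨0, 0, 0, -16465, -804972⟩ :=
    integralModelInt_eq_of_map_eq _ (by rw [hW]; ext <;> simp [WeierstrassCurve.map])
  have hΔ : (⟨0, 0, 0, -16465, -804972⟩ : WeierstrassCurve ℤ).Δ = discOf [0, 0, 0, -16465, -804972] :=
    intCurve_Δ 0 0 0 (-16465) (-804972)
  have hgood : W.HasGoodReductionAtPrime 3 :=
    hasGoodReductionAtPrime_of_not_dvd W 3 (by rw [minimalDiscriminantInt_eq hI, hΔ]; decide +kernel)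
  have hap : W.frobeniusTrace 3 = 0 := by rw [frobeniusTrace_eq hI card_nf481888n1_3]; norm_num
  exact forall_kobayashiMainConjecture_three_of_rows hCK h12 h41 hKim h5 h3 hGZK hmod' W hgood hap
    (SmallImageSelfTwist.not_surj_three_c481888n1 W hW) hf₀ hΘ₄ hΘ₄0 hμ₄ hlam₄ hΘ₅ hΘ₅0 hμ₅ hlam₅ hr
    (bsdp3_nn481888n1 hGZK W hW (hr.trans_le zero_le_one) hs hvs hSel)

end Records

end Summit.BirchSwinnertonDyer.BirchSwinnertonDyer.Theorems.SmallImageSignedMuNF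

end
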